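import Literature.Analysis.FluidPDE.NSLerayRegularisedLimitHolds
import Literature.Analysis.FluidPDE.NSLerayRegularisedExistenceProofs
import Literature.Analysis.FluidPDE.CKNTenThirdsInterpolation
import Literature.Analysis.FunctionSpaces.LpInterpolationConvergence
import Literature.Analysis.FluidPDE.MollifiedSliceTools
import HarnessLib

/-!
# Leray's regularised scheme with its pressure, and the global `L²`/`L³` convergence of the
# scheme to Leray's weak solution

Analysis/FluidPDE theorem file (no definitions, no named facts). First file of the proof that
**Leray's weak solutions are suitable** — the global Leray–Hopf weak solution of Leray's
*Théorème d'existence* (`leray_existence_R3_holds`, Leray 1934, Ch. V §31), obtained as the limit of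
the regularised scheme `∂ₜu − νΔu + ((J_ε u)·∇)u + ∇p = 0`, satisfies together with the Riesz
pressure the local energy inequality, i.e. is a local energy solution in the sense of
Seregin / Kikuchi–Seregin / Kang–Miura–Tsai on every strip `(EuclideanSpace ℝ (Fin 3)) × (0, T)` (Caffarelli–Kohn–Nirenberg
1982, Appendix, "the weak solutions constructed by Leray are suitable"; Lemarié-Rieusset 2016,
Thm. 12.2 and Prop. 14.3). That theorem is the existence input of the tree's proof of the
extension step for local energy solutions with `E²` data
(`localEnergySolution_extension_of_memE2`, `LocalEnergyExtension.lean`; Lemarié-Rieusset 2016,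
Thm. 14.8, proof, Step 2 = Seregin 2014, App. B §B.5), whose printed proof solves the finite-energy
part of the restarted datum "through the Leray mollification" (Lemarié-Rieusset, (14.32)).

This file records:

* `exists_lerayScheme_with_pressure` — Leray's regularised scheme **with its pressures**: for
  `ν > 0` and a weakly divergence-free `u₀ ∈ L²((EuclideanSpace ℝ (Fin 3)))` there are bump kernels `φ n` (radii `→ 0`),
  fields `U n` forming an `IsLerayRegularisedScheme ν u₀ φ U`, and pressures `P n` such that
  `(J_{φ n} U n, U n, P n)` is a classical solution of the drift system on every `[0, T]`
  (`IsClassicalDriftNSSolutionOn`), with Leray's bound `‖P n t‖₂ ≤ 9 ‖|J U n t| |U n t|‖₂`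
  (the construction of `leray_regularised_wellposed_holds`, Leray 1934, §26, kept with the
  pressure it produces);
* `IsLerayRegularisedScheme.exists_subseq_limit_package` — Leray's passage to the limit with its
  by-products kept: along a subsequence, a global Leray–Hopf weak solution `u`
  (`IsGlobalLerayHopf`) which is the slice-wise weak `L²` limit (`IsSliceWeakLimit`), jointly
  measurable, and the **strong `L²` limit at almost every time** (Leray 1934, §29; the assembly
  `IsLerayRegularisedScheme.exists_isGlobalLerayHopf` of `NSLerayRegularisedLimitHolds.lean` with
  its intermediate data exported);
* the **global space–time convergences** on every slab `(0, T) × (EuclideanSpace ℝ (Fin 3))` that the suitability proof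
  consumes: `∫₀ᵀ∫ |U n − u|² → 0` (dominated convergence in time), the uniform bound
  `∫₀ᵀ∫ |U n|^{10/3} ≤ M` (Sobolev `H¹ ⊂ L⁶` slice-wise and `‖f‖_{10/3}^{10/3} ≤ ‖f‖₂^{4/3}‖f‖₆²`,
  with the energy equality), hence `∫₀ᵀ∫ |U n − u|³ → 0`
  (`FunctionSpaces.tendsto_lintegral_enorm_rpow_three_of_sq_of_tenThirds`).

## References

* J. Leray, Acta Math. 63 (1934), Ch. V §§26–31. [Leray1934]
* L. Caffarelli, R. Kohn, L. Nirenberg, CPAM 35 (1982), §2 and Appendix. [CaffarelliKohnNirenberg1982]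
* P. G. Lemarié-Rieusset, *The Navier–Stokes Problem in the 21st Century* (2016), Thm. 12.2,
  Prop. 14.3, Thm. 14.8 (proof, Step 2, (14.32)). [LemarieRieusset2016]
* W. S. Ożański, B. C. Pooley, LMS Lecture Note Ser. 452 (2018), Thm. 6.37. [OzanskiPooley2018]
-/

noncomputable section

open MeasureTheory TopologicalSpace Set Function Filter Topology Real ContinuousLinearMap
open scoped InnerProductSpace RealInnerProductSpace ENNReal NNReal Laplacian Convolution

namespace Literature.Analysis.FluidPDE

/-! ## The scheme with its pressures -/

section SchemeWithPressure

open FourierNS.ClayDatum (reVec reVec_apply)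

/-- **Leray's regularised scheme together with its pressures** (Leray 1934, Ch. V §26, (5.1):
the regularised problem `∂ₜu − νΔu + ((J_χu)·∇)u + ∇p = 0` has a global regular solution for the
mollified datum `J_χ u₀`; Ożański–Pooley 2018, Thm. 6.33). For `ν > 0` and a weakly divergence-free
`u₀ ∈ L²((EuclideanSpace ℝ (Fin 3)))` there are bump kernels `φ n` with radii `→ 0`, velocities `U n` and pressures `P n`
such that `(φ, U)` is a Leray regularised scheme (`IsLerayRegularisedScheme`, all the clauses the
passage to the limit consumes) and, in addition, `(J_{φ n}(U n ·), U n, P n)` is a classical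
solution of the drift system on every `[0, T]`, with Leray's pressure bound
`‖P n t‖₂ ≤ 9 ‖|J_{φ n} U n t| · |U n t|‖₂` for `t ≥ 0`. Proof: the construction behind
`leray_regularised_wellposed_holds` (`FourierNS.exists_fourierDatum`,
`FourierNS.exists_global_regularised_fields`, `exists_leray_separation_of_energy'`), run along a
sequence of kernels (`FunctionSpaces.exists_contDiffBump_seq`), keeping the pressure.
[cite: Leray1934, Ch. V §26 (5.1), §27 (5.7)] [cite: OzanskiPooley2018, Thm. 6.33, Lemma 6.34] -/
theorem exists_lerayScheme_with_pressure {ν : ℝ} (hν : 0 < ν) {u₀ : (EuclideanSpace ℝ (Fin 3)) → (EuclideanSpace ℝ (Fin 3))}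
    (hu₀ : MemLp u₀ 2 volume) (hdiv : IsWeaklyDivFree u₀) :
    ∃ (φ : ℕ → ContDiffBump (0 : (EuclideanSpace ℝ (Fin 3)))) (U : ℕ → ℝ → (EuclideanSpace ℝ (Fin 3)) → (EuclideanSpace ℝ (Fin 3))) (P : ℕ → ℝ → (EuclideanSpace ℝ (Fin 3)) → ℝ),
      IsLerayRegularisedScheme ν u₀ φ U ∧
      (∀ n T, 0 < T →
        IsClassicalDriftNSSolutionOn (Icc 0 T) ν (fun t => mollify (φ n) (U n t)) (U n) (P n)) ∧
      (∀ n t, 0 ≤ t → eLpNorm (P n t) 2 volume ≤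
        ((9 : ℕ) : ℝ≥0∞) * eLpNorm (fun x => ‖mollify (φ n) (U n t) x‖ * ‖U n t x‖) 2 volume) := by
  -- the tail constant of the separation of energy, uniform in the kernel and the datum
  have hE : Module.finrank ℝ (EuclideanSpace ℝ (Fin 3)) = 3 := by simp
  obtain ⟨C, -, hC⟩ := exists_leray_separation_of_energy' (E := (EuclideanSpace ℝ (Fin 3))) hE hν
    ((Fintype.card (Fin 3) ^ 2 : ℕ) : ℝ≥0)
  have hK : Fintype.card (Fin 3) < 2 * 2 := by simp
  have hc : 0 < 4 * π ^ 2 * ν := by positivity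
  -- one kernel
  have hone : ∀ χ : ContDiffBump (0 : (EuclideanSpace ℝ (Fin 3))), ∃ (U : ℝ → (EuclideanSpace ℝ (Fin 3)) → (EuclideanSpace ℝ (Fin 3))) (P : ℝ → (EuclideanSpace ℝ (Fin 3)) → ℝ),
      (∀ T, 0 < T → IsClassicalDriftNSSolutionOn (Icc 0 T) ν (fun t => mollify χ (U t)) U P) ∧
      (∀ t, 0 ≤ t → eLpNorm (P t) 2 volume ≤
        ((9 : ℕ) : ℝ≥0∞) * eLpNorm (fun x => ‖mollify χ (U t) x‖ * ‖U t x‖) 2 volume) ∧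
      ContDiffOn ℝ 1 (uncurry U) (Ioi 0 ×ˢ univ) ∧
      ContinuousInLpOn (Ici 0) 2 U ∧
      (∀ t, 0 < t → VectorCalculus.IsDivFree (U t)) ∧
      (∀ ψ : ℝ → (EuclideanSpace ℝ (Fin 3)) → (EuclideanSpace ℝ (Fin 3)), IsSpaceTimeTestOn (⊤ : Opens (ℝ × (EuclideanSpace ℝ (Fin 3)))) ψ →
        (∀ τ, VectorCalculus.IsDivFree (ψ τ)) → ∀ s t, 0 ≤ s → s ≤ t →
          (∫ x, ⟪U t x, ψ t x⟫) - ∫ x, ⟪U s x, ψ s x⟫ =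
            ∫ τ in s..t, ∫ x, (⟪U τ x, timeDeriv ψ τ x⟫ +
              ⟪U τ x, convect (mollify χ (U τ)) (ψ τ) x⟫ + ν * ⟪U τ x, Δ (ψ τ) x⟫)) ∧
      (∀ T, ∫⁻ t in Ioo 0 T, ∫⁻ x, ENNReal.ofReal (frobeniusNormSq (fderiv ℝ (U t) x)) < ∞) ∧
      (∀ s t, 0 ≤ s → s ≤ t →
        VectorCalculus.kineticEnergy (U t) +
            ν * (∫⁻ τ in Ioo s t, ∫⁻ x,
              ENNReal.ofReal (frobeniusNormSq (fderiv ℝ (U τ) x))).toReal =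
          VectorCalculus.kineticEnergy (U s)) ∧
      (∀ (R₁ R₂ t : ℝ), 0 < R₁ → R₁ < R₂ → 0 ≤ t →
        ∫⁻ x in {x | R₂ < ‖x‖}, ‖U t x‖ₑ ^ 2 ≤
          (∫⁻ x in {x | R₁ < ‖x‖}, ‖U 0 x‖ₑ ^ 2) +
            ENNReal.ofReal (C * ((eLpNorm u₀ 2 volume).toReal ^ 3 * t ^ (1 / 4 : ℝ) +
              (eLpNorm u₀ 2 volume).toReal ^ 2 * t ^ (1 / 2 : ℝ)) / (R₂ - R₁))) ∧
      U 0 = mollify χ u₀ := by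
    intro χ
    obtain ⟨a, ha, hall, haF⟩ := FourierNS.exists_fourierDatum χ hu₀ hdiv hc hK
    obtain ⟨u, w, p, hsol, h0, hw, hcont, hdiss, henergy, hweak, hpress⟩ :=
      FourierNS.exists_global_regularised_fields hν ha hall
    -- the datum is attained: `u 0 = J_χ u₀`
    have hinit : u 0 = mollify χ u₀ := by
      funext x
      rw [h0 x]
      ext l
      rw [reVec_apply, haF x l, Complex.ofReal_re]
    -- the hypotheses of the separation of energy
    have htail : LerayTailHyp ν ((Fintype.card (Fin 3) ^ 2 : ℕ) : ℝ≥0) w u p :=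
      { solution := isClassicalDriftNSSolutionOn_Ioi_of_Icc hsol
        continuousInL2 := hcont
        dissipation_lt_top := hdiss
        energy_le := fun s t hs hst => le_of_eq (henergy s t hs hst)
        drift_two := fun t ht => by
          rw [hw t ht.le]
          exact eLpNorm_mollify_le χ (hcont.1 t ht.le).1
        drift_four := fun t ht => by
          rw [hw t ht.le]
          exact FunctionSpaces.eLpNorm_normed_convolution_le χ (hcont.1 t ht.le).1 (by norm_num)
        pressure_two := fun t ht => hpress t ht.le }
    have hcard : ((Fintype.card (Fin 3) ^ 2 : ℕ) : ℝ≥0) = ((9 : ℕ) : ℝ≥0) := by simp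
    refine ⟨u, p, fun T hT => ?_, fun t ht => ?_,
      contDiffOn_one_Ioi_of_Icc (fun T hT => (hsol T hT).smooth_velocity), hcont,
      fun t ht => (hsol t ht).divFree t ⟨ht.le, le_rfl⟩, hweak, hdiss, henergy, ?_, hinit⟩
    · -- the classical drift system with the drift written as `J_χ (u t)`
      exact (hsol T hT).congr (fun t _ => rfl) (fun t ht => (hw t ht.1).symm) fun t _ => rfl
    · -- the pressure bound
      have h := hpress t ht
      rw [hw t ht] at h
      have e : (((Fintype.card (Fin 3) ^ 2 : ℕ) : ℝ≥0) : ℝ≥0∞) = ((9 : ℕ) : ℝ≥0∞) := by simp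
      rw [e] at h
      exact h
    · -- the separation of energy with `M = ‖u₀‖₂ ≥ ‖J_χ u₀‖₂ = ‖u 0‖₂`
      intro R₁ R₂ t hR₁ hR ht
      have hM0 : 0 ≤ (eLpNorm u₀ 2 volume).toReal := ENNReal.toReal_nonneg
      have hM : eLpNorm (u 0) 2 volume ≤ ENNReal.ofReal (eLpNorm u₀ 2 volume).toReal := by
        rw [ENNReal.ofReal_toReal hu₀.eLpNorm_ne_top, hinit]
        exact eLpNorm_mollify_le χ hu₀.aestronglyMeasurable
      exact hC htail hM0 hM R₁ R₂ t hR₁ hR ht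
  -- along a sequence of kernels with radii tending to zero
  obtain ⟨χ, hχ, -⟩ := FunctionSpaces.exists_contDiffBump_seq (E := (EuclideanSpace ℝ (Fin 3)))
  choose U P hU using fun n => hone (χ n)
  refine ⟨χ, U, P, ?_, fun n => (hU n).1, fun n => (hU n).2.1⟩
  exact
    { tendsto_rOut := hχ
      contDiffOn := fun n => (hU n).2.2.1
      continuousInL2 := fun n => (hU n).2.2.2.1
      divFree := fun n => (hU n).2.2.2.2.1
      regularised := fun n => (hU n).2.2.2.2.2.1
      dissipation_lt_top := fun n => (hU n).2.2.2.2.2.2.1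
      energy_eq := fun n => (hU n).2.2.2.2.2.2.2.1
      tail := ⟨fun t => C * ((eLpNorm u₀ 2 volume).toReal ^ 3 * t ^ (1 / 4 : ℝ) +
          (eLpNorm u₀ 2 volume).toReal ^ 2 * t ^ (1 / 2 : ℝ)),
        fun n => (hU n).2.2.2.2.2.2.2.2.1⟩
      initial := fun n => (hU n).2.2.2.2.2.2.2.2.2 }

end SchemeWithPressure

/-! ## Leray's passage to the limit with its by-products -/

section LimitPackage

variable {E : Type*} [NormedAddCommGroup E] [InnerProductSpace ℝ E] [FiniteDimensional ℝ E]
  [MeasurableSpace E] [BorelSpace E]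
variable {ν : ℝ} {u₀ : E → E} {φ : ℕ → ContDiffBump (0 : E)} {U : ℕ → ℝ → E → E}

/-- **Leray's passage to the limit, with its by-products kept** (Leray 1934, Ch. V §§28–31;
Ożański–Pooley 2018, Thm. 6.37): for `ν > 0` and a weakly divergence-free `u₀ ∈ L²`, every Leray
regularised scheme has a subsequence `U ∘ κ` and a field `u` such that `u` is a global Leray–Hopf
weak solution with datum `u₀`, the slices `U (κ n) t` converge to `u t` weakly in `L²` for every
`t ≥ 0` (`IsSliceWeakLimit`, with `u 0 = u₀` and `‖u t‖₂ ≤ ‖u₀‖₂`) and **strongly in `L²` for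
almost every `t > 0`** (Leray 1934, §29), and `u` is jointly measurable on `(0, ∞) × E`. This is the
proof of `IsLerayRegularisedScheme.exists_isGlobalLerayHopf` with its intermediate data exported.
[cite: Leray1934, Ch. V §§28–31] [cite: OzanskiPooley2018, Thm. 6.37] -/
theorem IsLerayRegularisedScheme.exists_subseq_limit_package
    (hS : IsLerayRegularisedScheme ν u₀ φ U) (hν : 0 < ν) (hu₀ : MemLp u₀ 2 volume)
    (hdiv₀ : IsWeaklyDivFree u₀) :
    ∃ (κ : ℕ → ℕ) (u : ℝ → E → E), StrictMono κ ∧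
      IsSliceWeakLimit (fun n => U (κ n)) u₀ u ∧
      AEStronglyMeasurable (uncurry u) ((volume.restrict (Ioi (0 : ℝ))).prod (volume : Measure E)) ∧
      (∀ᵐ t ∂(volume.restrict (Ioi (0 : ℝ))),
        Tendsto (fun n => eLpNorm (U (κ n) t - u t) 2 volume) atTop (𝓝 0)) ∧
      IsGlobalLerayHopf ν 0 u₀ u := by
  -- Step 1 and Helly along subsequences
  obtain ⟨ψ₁, u₁, hψ₁, hW₁⟩ := hS.exists_subseq_isSliceWeakLimit hν.le hu₀ hdiv₀
  have hS₁ := hS.comp_strictMono hψ₁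
  obtain ⟨ψ₂, hψ₂, J, hJc, hKE⟩ := hS₁.exists_subseq_tendsto_kineticEnergy hν.le hu₀
  have hS₂ := hS₁.comp_strictMono hψ₂
  have hW₂ : IsSliceWeakLimit (fun n => U (ψ₁ (ψ₂ n))) u₀ u₁ := hW₁.comp_strictMono hψ₂
  -- Step 3: strong convergence at a.e. time
  have hae₁ := hS₂.ae_tendsto_eLpNorm_sub hν hu₀ hW₂ hJc hKE
  -- the jointly measurable representative
  obtain ⟨u, hW, hslice, hmeas⟩ := hS₂.exists_measurable_sliceWeakLimit hν hu₀ hW₂ hae₁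
  have hae : ∀ᵐ t ∂(volume.restrict (Ioi (0 : ℝ))),
      Tendsto (fun n => eLpNorm (U (ψ₁ (ψ₂ n)) t - u t) 2 volume) atTop (𝓝 0) := by
    filter_upwards [hae₁, ae_restrict_mem (measurableSet_Ioi : MeasurableSet (Ioi (0 : ℝ)))]
      with t ht ht0
    refine ht.congr fun n => eLpNorm_congr_ae ?_
    filter_upwards [hslice t (le_of_lt ht0)] with x hx
    simp only [Pi.sub_apply, hx]
  refine ⟨fun n => ψ₁ (ψ₂ n), u, hψ₁.comp hψ₂, hW, hmeas, hae, fun T hT => ?_⟩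
  obtain ⟨G, hG, hGint, hE0, hEs⟩ := hS₂.weakGrad_energy_limit hν hu₀ hW hae hT
  exact fluid_isLerayHopfOn_of_clauses hT hν.le hu₀ (hS₂.isWeakNSSolutionOn_limit hν hu₀ hW hmeas hae hT)
    (hW.energy_bound hu₀ T) (fun t ht => hW.memLp t ht.1) ⟨G, hG, hGint, hE0, hEs⟩
    (fun w hw => hS₂.weak_continuous_limit hν.le hu₀ hW T w hw)

end LimitPackage


/-! ## Global space–time convergence on slabs -/

section SlabConvergence

variable {E : Type*} [NormedAddCommGroup E] [InnerProductSpace ℝ E] [FiniteDimensional ℝ E]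
  [MeasurableSpace E] [BorelSpace E]
variable {ν : ℝ} {u₀ : E → E} {φ : ℕ → ContDiffBump (0 : E)} {U : ℕ → ℝ → E → E} {u : ℝ → E → E}

/-- The slab product measure is dominated by the half-space–time product measure. [folklore] -/
theorem prod_restrict_Ioo_le_prod_restrict_Ioi (T : ℝ) :
    (volume.restrict (Ioo (0 : ℝ) T)).prod (volume : Measure E) ≤
      (volume.restrict (Ioi (0 : ℝ))).prod (volume : Measure E) :=
  Measure.prod_mono (Measure.restrict_mono Ioo_subset_Ioi_self le_rfl) le_rfl

/-- The fields of a regularised scheme are a.e. strongly measurable for the slab product measure.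
[folklore] -/
theorem IsLerayRegularisedScheme.aestronglyMeasurable_uncurry_slab
    (hS : IsLerayRegularisedScheme ν u₀ φ U) (n : ℕ) (T : ℝ) :
    AEStronglyMeasurable (uncurry (U n)) ((volume.restrict (Ioo (0 : ℝ) T)).prod (volume : Measure E)) :=
  (hS.aestronglyMeasurable_uncurry n).mono_measure (prod_restrict_Ioo_le_prod_restrict_Ioi T)

/-- `∫⁻ ‖f‖ₑ² = ‖f‖₂²`. [folklore] -/
theorem lintegral_enorm_sq_eq_eLpNorm_sq' {α : Type*} {m : MeasurableSpace α} (μ : Measure α)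
    {F : Type*} [NormedAddCommGroup F] (f : α → F) : ∫⁻ x, ‖f x‖ₑ ^ 2 ∂μ = eLpNorm f 2 μ ^ 2 := by
  have h := eLpNorm_natCast_pow_eq_lintegral μ f (n := 2) two_ne_zero
  simpa only [Nat.cast_ofNat] using h.symm

/-- **Strong `L²` convergence on every slab** (Leray 1934, §29: convergence en moyenne at almost
every time, integrated in time): if `U n t → u t` in `L²(E)` for a.e. `t > 0` along a Leray
regularised scheme with slice-wise weak limit `u`, then `∫₀ᵀ∫ |U n − u|² → 0` for every `T`
(dominated convergence in time, the slices being bounded by `‖u₀‖₂`). [cite: Leray1934, Ch. V §29] -/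
theorem IsLerayRegularisedScheme.tendsto_lintegral_prod_sub_sq
    (hS : IsLerayRegularisedScheme ν u₀ φ U) (hν : 0 < ν) (hu₀ : MemLp u₀ 2 volume)
    (hW : IsSliceWeakLimit U u₀ u)
    (hmeas : AEStronglyMeasurable (uncurry u) ((volume.restrict (Ioi (0 : ℝ))).prod (volume : Measure E)))
    (hae : ∀ᵐ t ∂(volume.restrict (Ioi (0 : ℝ))),
      Tendsto (fun n => eLpNorm (U n t - u t) 2 volume) atTop (𝓝 0)) (T : ℝ) :
    Tendsto (fun n => ∫⁻ z, ‖U n z.1 z.2 - u z.1 z.2‖ₑ ^ 2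
      ∂((volume.restrict (Ioo (0 : ℝ) T)).prod (volume : Measure E))) atTop (𝓝 0) := by
  set μt : Measure ℝ := volume.restrict (Ioo (0 : ℝ) T) with hμt
  haveI : IsFiniteMeasure μt := ⟨by rw [hμt, Measure.restrict_apply_univ]; exact measure_Ioo_lt_top⟩
  -- the slice functional and its bound
  set F : ℕ → ℝ → ℝ≥0∞ := fun n t => ∫⁻ x, ‖U n t x - u t x‖ₑ ^ 2 with hF
  set B : ℝ≥0∞ := (2 * eLpNorm u₀ 2 volume) ^ 2 with hB
  have hBtop : B ≠ ∞ := ENNReal.pow_ne_top (ENNReal.mul_ne_top ENNReal.ofNat_ne_top hu₀.eLpNorm_ne_top)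
  -- measurability of the slice functionals
  have hmeasU : ∀ n, AEStronglyMeasurable (uncurry (U n)) (μt.prod (volume : Measure E)) := fun n =>
    hS.aestronglyMeasurable_uncurry_slab n T
  have hmeasu : AEStronglyMeasurable (uncurry u) (μt.prod (volume : Measure E)) :=
    hmeas.mono_measure (prod_restrict_Ioo_le_prod_restrict_Ioi T)
  have hFm : ∀ n, AEMeasurable (F n) μt := fun n => by
    have h : AEMeasurable (fun z : ℝ × E => ‖U n z.1 z.2 - u z.1 z.2‖ₑ ^ 2) (μt.prod volume) :=
      ((hmeasU n).sub hmeasu).enorm.pow_const 2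
    exact h.lintegral_prod_right'
  -- the bound at every `t ∈ (0, T)`
  have hFB : ∀ n, F n ≤ᵐ[μt] fun _ => B := fun n => by
    filter_upwards [ae_restrict_mem (measurableSet_Ioo : MeasurableSet (Ioo (0 : ℝ) T))] with t ht
    have e : ∫⁻ x, ‖U n t x - u t x‖ₑ ^ 2 = eLpNorm (U n t - u t) 2 volume ^ 2 :=
      lintegral_enorm_sq_eq_eLpNorm_sq' volume (U n t - u t)
    show ∫⁻ x, ‖U n t x - u t x‖ₑ ^ 2 ≤ B
    rw [e, hB]
    gcongr
    calc eLpNorm (U n t - u t) 2 volume ≤ eLpNorm (U n t) 2 volume + eLpNorm (u t) 2 volume :=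
          eLpNorm_sub_le (hS.memLp n ht.1.le).1 (hW.memLp t ht.1.le).1 one_le_two
      _ ≤ eLpNorm u₀ 2 volume + eLpNorm u₀ 2 volume :=
          add_le_add (hS.eLpNorm_le hν.le hu₀ n ht.1.le) (hW.eLpNorm_le t ht.1.le)
      _ = 2 * eLpNorm u₀ 2 volume := by ring
  have hfin : ∫⁻ _t, B ∂μt ≠ ∞ := by
    rw [lintegral_const]; exact ENNReal.mul_ne_top hBtop (measure_ne_top _ _)
  -- convergence of the slice functionals at a.e. time
  have hlim : ∀ᵐ t ∂μt, Tendsto (fun n => F n t) atTop (𝓝 0) := by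
    have h1 : ∀ᵐ t ∂μt, Tendsto (fun n => eLpNorm (U n t - u t) 2 volume) atTop (𝓝 0) :=
      ae_restrict_of_ae_restrict_of_subset Ioo_subset_Ioi_self hae
    filter_upwards [h1] with t ht
    have h2 : Tendsto (fun n => eLpNorm (U n t - u t) 2 volume ^ 2) atTop (𝓝 0) := by
      have := (ENNReal.continuous_pow 2).tendsto 0 |>.comp ht
      rwa [zero_pow two_ne_zero] at this
    refine h2.congr fun n => ?_
    exact (lintegral_enorm_sq_eq_eLpNorm_sq' volume (U n t - u t)).symm
  have hDC := tendsto_lintegral_of_dominated_convergence' (fun _ => B) hFm hFB hfin hlim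
  rw [lintegral_zero] at hDC
  -- the slab integral is the iterated integral
  refine hDC.congr fun n => ?_
  have h : AEMeasurable (fun z : ℝ × E => ‖U n z.1 z.2 - u z.1 z.2‖ₑ ^ 2) (μt.prod volume) :=
    ((hmeasU n).sub hmeasu).enorm.pow_const 2
  exact (lintegral_prod _ h).symm

/-- **The uniform `L^{10/3}` bound on slabs** (Leray 1934, §27/§31 energy bounds with the Sobolev
inequality; Caffarelli–Kohn–Nirenberg 1982, (2.8)–(2.9): `L^∞L² ∩ L²Ḣ¹ ⊂ L^{10/3}`): along a Leray
regularised scheme with `ν > 0`, `∫₀ᵀ∫ |U n|^{10/3} ≤ M < ∞` uniformly in `n`, with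
`M = (‖u₀‖₂²)^{2/3} K² E(u₀)/ν` (`K` the Gagliardo–Nirenberg–Sobolev constant): slice-wise
`∫|U|^{10/3} ≤ (∫|U|²)^{2/3} (∫|U|⁶)^{1/3}` and `‖U‖₆ ≤ K ‖∇U‖₂`, then the dissipation bound
`ν∫₀ᵀ∫|∇U n|² ≤ E(u₀)`. Requires `dim E = 3`. [cite: CaffarelliKohnNirenberg1982, §2 (2.8)–(2.9)] -/
theorem IsLerayRegularisedScheme.lintegral_prod_tenThirds_le (hE : Module.finrank ℝ E = 3)
    (hS : IsLerayRegularisedScheme ν u₀ φ U) (hν : 0 < ν) (hu₀ : MemLp u₀ 2 volume) (n : ℕ)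
    {T : ℝ} (hT : 0 ≤ T) :
    ∫⁻ z, ‖U n z.1 z.2‖ₑ ^ (10 / 3 : ℝ) ∂((volume.restrict (Ioo (0 : ℝ) T)).prod (volume : Measure E)) ≤
      (eLpNorm u₀ 2 volume ^ 2) ^ (2 / 3 : ℝ) *
        ((SNormLESNormFDerivOfEqConst E (volume : Measure E) 2 : ℝ≥0∞) ^ 2 *
          ENNReal.ofReal (VectorCalculus.kineticEnergy u₀ / ν)) := by
  set μt : Measure ℝ := volume.restrict (Ioo (0 : ℝ) T) with hμt
  set A : ℝ≥0∞ := eLpNorm u₀ 2 volume ^ 2 with hA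
  set Kc : ℝ≥0∞ := (SNormLESNormFDerivOfEqConst E (volume : Measure E) 2 : ℝ≥0∞) with hKc
  set D : ℕ → ℝ → ℝ≥0∞ := fun n t => ∫⁻ x, ENNReal.ofReal (frobeniusNormSq (fderiv ℝ (U n t) x))
    with hD
  -- the slice bound
  have hslice : ∀ t ∈ Ioo (0 : ℝ) T,
      ∫⁻ x, ‖U n t x‖ₑ ^ (10 / 3 : ℝ) ≤ A ^ (2 / 3 : ℝ) * (Kc ^ 2 * D n t) := by
    intro t ht
    have hm : AEMeasurable (fun x => ‖U n t x‖ₑ) (volume : Measure E) := (hS.memLp n ht.1.le).1.enorm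
    have h1 := lintegral_rpow_tenThirds_le_Lp_interpolation (volume : Measure E) hm
    refine h1.trans (mul_le_mul' ?_ ?_)
    · -- `(∫|U|²)^{2/3} ≤ (‖u₀‖₂²)^{2/3}`
      refine ENNReal.rpow_le_rpow ?_ (by norm_num)
      rw [lintegral_enorm_sq_eq_eLpNorm_sq' volume (U n t), hA]
      gcongr
      exact hS.eLpNorm_le hν.le hu₀ n ht.1.le
    · -- `(∫|U|⁶)^{1/3} ≤ K² ∫|∇U|²`
      have h6 : eLpNorm (U n t) 6 volume ≤ Kc * (D n t) ^ (1 / 2 : ℝ) :=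
        eLpNorm_six_le_frobenius_of_hasWeakGradient hE (hS.memLp n ht.1.le)
          (hS.hasWeakGradient_slice n ht.1)
      have e6 : ∫⁻ x, ‖U n t x‖ₑ ^ (6 : ℝ) = eLpNorm (U n t) 6 volume ^ (6 : ℝ) := by
        have h := eLpNorm_natCast_pow_eq_lintegral volume (U n t) (n := 6) (by norm_num)
        simp only [Nat.cast_ofNat] at h
        rw [← ENNReal.rpow_natCast] at h
        simp only [Nat.cast_ofNat] at h
        rw [h]
        refine lintegral_congr fun x => ?_
        rw [← ENNReal.rpow_natCast]
        simp
      rw [e6, ← ENNReal.rpow_mul, show (6 : ℝ) * (1 / 3) = 2 by norm_num]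
      calc eLpNorm (U n t) 6 volume ^ (2 : ℝ) ≤ (Kc * (D n t) ^ (1 / 2 : ℝ)) ^ (2 : ℝ) :=
            ENNReal.rpow_le_rpow h6 (by norm_num)
        _ = Kc ^ 2 * D n t := by
            rw [ENNReal.mul_rpow_of_nonneg _ _ (by norm_num), ← ENNReal.rpow_mul,
              show (1 / 2 : ℝ) * 2 = 1 by norm_num, ENNReal.rpow_one]
            simp
  -- integrate in time
  calc ∫⁻ z, ‖U n z.1 z.2‖ₑ ^ (10 / 3 : ℝ) ∂(μt.prod (volume : Measure E))
      ≤ ∫⁻ t, (∫⁻ x, ‖U n t x‖ₑ ^ (10 / 3 : ℝ)) ∂μt := lintegral_prod_le _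
    _ ≤ ∫⁻ t, A ^ (2 / 3 : ℝ) * (Kc ^ 2 * D n t) ∂μt := by
        refine lintegral_mono_ae ?_
        filter_upwards [ae_restrict_mem (measurableSet_Ioo : MeasurableSet (Ioo (0 : ℝ) T))] with t ht
        exact hslice t ht
    _ = A ^ (2 / 3 : ℝ) * (Kc ^ 2 * ∫⁻ t, D n t ∂μt) := by
        have hDm : AEMeasurable (D n) μt :=
          (hS.aemeasurable_dissipation n).mono_measure (Measure.restrict_mono Ioo_subset_Ioi_self le_rfl)
        rw [lintegral_const_mul'' _ (hDm.const_mul _), lintegral_const_mul'' _ hDm]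
    _ ≤ A ^ (2 / 3 : ℝ) * (Kc ^ 2 * ENNReal.ofReal (VectorCalculus.kineticEnergy u₀ / ν)) := by
        gcongr
        exact hS.lintegral_dissipation_le hν hu₀ n hT

/-- The `L^{10/3}` slab constant is finite. [folklore] -/
theorem tenThirds_const_ne_top {ν : ℝ} (hu₀ : MemLp u₀ 2 volume) :
    (eLpNorm u₀ 2 volume ^ 2) ^ (2 / 3 : ℝ) *
        ((SNormLESNormFDerivOfEqConst E (volume : Measure E) 2 : ℝ≥0∞) ^ 2 *
          ENNReal.ofReal (VectorCalculus.kineticEnergy u₀ / ν)) ≠ ∞ :=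
  ENNReal.mul_ne_top (ENNReal.rpow_ne_top_of_nonneg (by norm_num) (ENNReal.pow_ne_top hu₀.eLpNorm_ne_top))
    (ENNReal.mul_ne_top (ENNReal.pow_ne_top ENNReal.coe_ne_top) ENNReal.ofReal_ne_top)

/-- **Strong `L³` convergence on every slab** (Caffarelli–Kohn–Nirenberg 1982, Appendix;
Lemarié-Rieusset 2016, Thm. 12.2): `∫₀ᵀ∫ |U n − u|³ → 0`, from the `L²` convergence
(`tendsto_lintegral_prod_sub_sq`) and the uniform `L^{10/3}` bound
(`lintegral_prod_tenThirds_le`) by `FunctionSpaces.tendsto_lintegral_enorm_rpow_three_of_sq_of_tenThirds`.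
Requires `dim E = 3`. [cite: CaffarelliKohnNirenberg1982, Appendix] -/
theorem IsLerayRegularisedScheme.tendsto_lintegral_prod_sub_cube (hE : Module.finrank ℝ E = 3)
    (hS : IsLerayRegularisedScheme ν u₀ φ U) (hν : 0 < ν) (hu₀ : MemLp u₀ 2 volume)
    (hW : IsSliceWeakLimit U u₀ u)
    (hmeas : AEStronglyMeasurable (uncurry u) ((volume.restrict (Ioi (0 : ℝ))).prod (volume : Measure E)))
    (hae : ∀ᵐ t ∂(volume.restrict (Ioi (0 : ℝ))),
      Tendsto (fun n => eLpNorm (U n t - u t) 2 volume) atTop (𝓝 0)) {T : ℝ} (hT : 0 ≤ T) :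
    Tendsto (fun n => ∫⁻ z, ‖U n z.1 z.2 - u z.1 z.2‖ₑ ^ (3 : ℝ)
      ∂((volume.restrict (Ioo (0 : ℝ) T)).prod (volume : Measure E))) atTop (𝓝 0) := by
  have hf : ∀ n, AEStronglyMeasurable (fun z : ℝ × E => U n z.1 z.2)
      ((volume.restrict (Ioo (0 : ℝ) T)).prod (volume : Measure E)) := fun n =>
    hS.aestronglyMeasurable_uncurry_slab n T
  have hg : AEStronglyMeasurable (fun z : ℝ × E => u z.1 z.2)
      ((volume.restrict (Ioo (0 : ℝ) T)).prod (volume : Measure E)) :=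
    hmeas.mono_measure (prod_restrict_Ioo_le_prod_restrict_Ioi T)
  exact FunctionSpaces.tendsto_lintegral_enorm_rpow_three_of_sq_of_tenThirds hf hg
    (hS.tendsto_lintegral_prod_sub_sq hν hu₀ hW hmeas hae T) (tenThirds_const_ne_top (ν := ν) hu₀)
    fun n => hS.lintegral_prod_tenThirds_le hE hν hu₀ n hT

end SlabConvergence


/-! ## `L³` bounds on slabs, `L³` slices, and the mollified velocities -/

section CubicAndMollified

variable {E : Type*} [NormedAddCommGroup E] [InnerProductSpace ℝ E] [FiniteDimensional ℝ E]
  [MeasurableSpace E] [BorelSpace E]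
variable {ν : ℝ} {u₀ : E → E} {φ : ℕ → ContDiffBump (0 : E)} {U : ℕ → ℝ → E → E} {u : ℝ → E → E}

/-- `x³ ≤ x² + x^{10/3}` in `ℝ≥0∞` (split at `x = 1`). [folklore] -/
theorem ENNReal.rpow_three_le_sq_add_tenThirds (x : ℝ≥0∞) :
    x ^ (3 : ℝ) ≤ x ^ 2 + x ^ (10 / 3 : ℝ) := by
  rcases le_total x 1 with h | h
  · calc x ^ (3 : ℝ) ≤ x ^ (2 : ℝ) := ENNReal.rpow_le_rpow_of_exponent_ge h (by norm_num)
      _ = x ^ 2 := by rw [← ENNReal.rpow_natCast]; norm_num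
      _ ≤ x ^ 2 + x ^ (10 / 3 : ℝ) := le_self_add
  · calc x ^ (3 : ℝ) ≤ x ^ (10 / 3 : ℝ) := ENNReal.rpow_le_rpow_of_exponent_le h (by norm_num)
      _ ≤ x ^ 2 + x ^ (10 / 3 : ℝ) := le_add_self

/-- `∫⁻ ‖f‖ₑ³ = ‖f‖₃³` (real exponent `3`). [folklore] -/
private theorem lintegral_enorm_rpow_three_eq₀ {α : Type*} {m : MeasurableSpace α} (μ : Measure α)
    {F : Type*} [NormedAddCommGroup F] (f : α → F) :
    ∫⁻ x, ‖f x‖ₑ ^ (3 : ℝ) ∂μ = eLpNorm f 3 μ ^ (3 : ℝ) := by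
  rw [eLpNorm_eq_lintegral_rpow_enorm_toReal (by norm_num) (by norm_num), ENNReal.toReal_ofNat,
    ← ENNReal.rpow_mul, one_div, inv_mul_cancel₀ (by norm_num : (3 : ℝ) ≠ 0), ENNReal.rpow_one]

/-- **The uniform `L²` bound on slabs**: `∫₀ᵀ∫ |U n|² ≤ T ‖u₀‖₂²`. [cite: OzanskiPooley2018, (6.88)] -/
theorem IsLerayRegularisedScheme.lintegral_prod_sq_le
    (hS : IsLerayRegularisedScheme ν u₀ φ U) (hν : 0 < ν) (hu₀ : MemLp u₀ 2 volume) (n : ℕ) (T : ℝ) :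
    ∫⁻ z, ‖U n z.1 z.2‖ₑ ^ 2 ∂((volume.restrict (Ioo (0 : ℝ) T)).prod (volume : Measure E)) ≤
      ENNReal.ofReal T * eLpNorm u₀ 2 volume ^ 2 := by
  set μt : Measure ℝ := volume.restrict (Ioo (0 : ℝ) T) with hμt
  calc ∫⁻ z, ‖U n z.1 z.2‖ₑ ^ 2 ∂(μt.prod (volume : Measure E))
      ≤ ∫⁻ t, (∫⁻ x, ‖U n t x‖ₑ ^ 2) ∂μt := lintegral_prod_le _
    _ ≤ ∫⁻ _t, eLpNorm u₀ 2 volume ^ 2 ∂μt := by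
        refine lintegral_mono_ae ?_
        filter_upwards [ae_restrict_mem (measurableSet_Ioo : MeasurableSet (Ioo (0 : ℝ) T))] with t ht
        rw [lintegral_enorm_sq_eq_eLpNorm_sq' volume (U n t)]
        gcongr
        exact hS.eLpNorm_le hν.le hu₀ n ht.1.le
    _ = ENNReal.ofReal T * eLpNorm u₀ 2 volume ^ 2 := by
        rw [lintegral_const, hμt, Measure.restrict_apply_univ, Real.volume_Ioo, sub_zero, mul_comm]

/-- **The uniform `L³` bound on slabs**: `∫₀ᵀ∫ |U n|³ ≤ T‖u₀‖₂² + M_{10/3}` uniformly in `n`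
(`|U|³ ≤ |U|² + |U|^{10/3}` pointwise). Requires `dim E = 3`.
[cite: CaffarelliKohnNirenberg1982, §2 (2.8)–(2.9)] -/
theorem IsLerayRegularisedScheme.lintegral_prod_cube_le (hE : Module.finrank ℝ E = 3)
    (hS : IsLerayRegularisedScheme ν u₀ φ U) (hν : 0 < ν) (hu₀ : MemLp u₀ 2 volume) (n : ℕ)
    {T : ℝ} (hT : 0 ≤ T) :
    ∫⁻ z, ‖U n z.1 z.2‖ₑ ^ (3 : ℝ) ∂((volume.restrict (Ioo (0 : ℝ) T)).prod (volume : Measure E)) ≤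
      ENNReal.ofReal T * eLpNorm u₀ 2 volume ^ 2 +
        (eLpNorm u₀ 2 volume ^ 2) ^ (2 / 3 : ℝ) *
          ((SNormLESNormFDerivOfEqConst E (volume : Measure E) 2 : ℝ≥0∞) ^ 2 *
            ENNReal.ofReal (VectorCalculus.kineticEnergy u₀ / ν)) := by
  calc ∫⁻ z, ‖U n z.1 z.2‖ₑ ^ (3 : ℝ) ∂((volume.restrict (Ioo (0 : ℝ) T)).prod (volume : Measure E))
      ≤ ∫⁻ z, (‖U n z.1 z.2‖ₑ ^ 2 + ‖U n z.1 z.2‖ₑ ^ (10 / 3 : ℝ))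
          ∂((volume.restrict (Ioo (0 : ℝ) T)).prod (volume : Measure E)) :=
        lintegral_mono fun z => ENNReal.rpow_three_le_sq_add_tenThirds _
    _ = (∫⁻ z, ‖U n z.1 z.2‖ₑ ^ 2 ∂((volume.restrict (Ioo (0 : ℝ) T)).prod (volume : Measure E))) +
          ∫⁻ z, ‖U n z.1 z.2‖ₑ ^ (10 / 3 : ℝ) ∂((volume.restrict (Ioo (0 : ℝ) T)).prod (volume : Measure E)) :=
        lintegral_add_left' ((hS.aestronglyMeasurable_uncurry_slab n T).enorm.pow_const _) _
    _ ≤ _ := add_le_add (hS.lintegral_prod_sq_le hν hu₀ n T) (hS.lintegral_prod_tenThirds_le hE hν hu₀ n hT)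

/-- The `L³` slab constant is finite. [folklore] -/
theorem cube_const_ne_top {ν : ℝ} (hu₀ : MemLp u₀ 2 volume) (T : ℝ) :
    ENNReal.ofReal T * eLpNorm u₀ 2 volume ^ 2 +
        (eLpNorm u₀ 2 volume ^ 2) ^ (2 / 3 : ℝ) *
          ((SNormLESNormFDerivOfEqConst E (volume : Measure E) 2 : ℝ≥0∞) ^ 2 *
            ENNReal.ofReal (VectorCalculus.kineticEnergy u₀ / ν)) ≠ ∞ :=
  ENNReal.add_ne_top.2 ⟨ENNReal.mul_ne_top ENNReal.ofReal_ne_top (ENNReal.pow_ne_top hu₀.eLpNorm_ne_top),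
    tenThirds_const_ne_top (ν := ν) hu₀⟩

/-- **The limit is in `L³` of every slab**: `∫₀ᵀ∫ |u|³ < ∞` (from the `L³` convergence and the
uniform `L³` bound of the scheme). Requires `dim E = 3`. [cite: CaffarelliKohnNirenberg1982, Appendix] -/
theorem IsLerayRegularisedScheme.lintegral_prod_cube_limit_lt_top (hE : Module.finrank ℝ E = 3)
    (hS : IsLerayRegularisedScheme ν u₀ φ U) (hν : 0 < ν) (hu₀ : MemLp u₀ 2 volume)
    (hW : IsSliceWeakLimit U u₀ u)
    (hmeas : AEStronglyMeasurable (uncurry u) ((volume.restrict (Ioi (0 : ℝ))).prod (volume : Measure E)))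
    (hae : ∀ᵐ t ∂(volume.restrict (Ioi (0 : ℝ))),
      Tendsto (fun n => eLpNorm (U n t - u t) 2 volume) atTop (𝓝 0)) {T : ℝ} (hT : 0 ≤ T) :
    ∫⁻ z, ‖u z.1 z.2‖ₑ ^ (3 : ℝ) ∂((volume.restrict (Ioo (0 : ℝ) T)).prod (volume : Measure E)) < ∞ := by
  set μT := (volume.restrict (Ioo (0 : ℝ) T)).prod (volume : Measure E) with hμT
  have hconv := hS.tendsto_lintegral_prod_sub_cube hE hν hu₀ hW hmeas hae hT
  -- some approximant is within `1` of the limit in `L³`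
  obtain ⟨n, hn⟩ : ∃ n, ∫⁻ z, ‖U n z.1 z.2 - u z.1 z.2‖ₑ ^ (3 : ℝ) ∂μT ≤ 1 := by
    have h := (ENNReal.tendsto_nhds_zero.1 hconv) 1 one_pos
    exact h.exists
  have hpt : ∀ z : ℝ × E, ‖u z.1 z.2‖ₑ ^ (3 : ℝ) ≤
      2 ^ (3 - 1 : ℝ) * (‖U n z.1 z.2 - u z.1 z.2‖ₑ ^ (3 : ℝ) + ‖U n z.1 z.2‖ₑ ^ (3 : ℝ)) := by
    intro z
    have e : u z.1 z.2 = U n z.1 z.2 - (U n z.1 z.2 - u z.1 z.2) := by abel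
    calc ‖u z.1 z.2‖ₑ ^ (3 : ℝ) = ‖U n z.1 z.2 - (U n z.1 z.2 - u z.1 z.2)‖ₑ ^ (3 : ℝ) := by rw [← e]
      _ ≤ (‖U n z.1 z.2‖ₑ + ‖U n z.1 z.2 - u z.1 z.2‖ₑ) ^ (3 : ℝ) := by
          gcongr
          exact enorm_sub_le
      _ ≤ 2 ^ (3 - 1 : ℝ) * (‖U n z.1 z.2‖ₑ ^ (3 : ℝ) + ‖U n z.1 z.2 - u z.1 z.2‖ₑ ^ (3 : ℝ)) :=
          ENNReal.rpow_add_le_mul_rpow_add_rpow _ _ (by norm_num)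
      _ = 2 ^ (3 - 1 : ℝ) * (‖U n z.1 z.2 - u z.1 z.2‖ₑ ^ (3 : ℝ) + ‖U n z.1 z.2‖ₑ ^ (3 : ℝ)) := by
          rw [add_comm]
  calc ∫⁻ z, ‖u z.1 z.2‖ₑ ^ (3 : ℝ) ∂μT
      ≤ ∫⁻ z, 2 ^ (3 - 1 : ℝ) * (‖U n z.1 z.2 - u z.1 z.2‖ₑ ^ (3 : ℝ) + ‖U n z.1 z.2‖ₑ ^ (3 : ℝ)) ∂μT :=
        lintegral_mono hpt
    _ ≤ 2 ^ (3 - 1 : ℝ) * ∫⁻ z, (‖U n z.1 z.2 - u z.1 z.2‖ₑ ^ (3 : ℝ) + ‖U n z.1 z.2‖ₑ ^ (3 : ℝ)) ∂μT := by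
        rw [← lintegral_const_mul' _ _ (ENNReal.rpow_ne_top_of_nonneg (by norm_num) ENNReal.ofNat_ne_top)]
    _ = 2 ^ (3 - 1 : ℝ) * ((∫⁻ z, ‖U n z.1 z.2 - u z.1 z.2‖ₑ ^ (3 : ℝ) ∂μT) +
          ∫⁻ z, ‖U n z.1 z.2‖ₑ ^ (3 : ℝ) ∂μT) := by
        have hm : AEMeasurable (fun z : ℝ × E => ‖U n z.1 z.2‖ₑ ^ (3 : ℝ)) μT :=
          (hS.aestronglyMeasurable_uncurry_slab n T).enorm.pow_const _
        rw [lintegral_add_right' _ hm]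
    _ < ∞ := by
        refine ENNReal.mul_lt_top (ENNReal.rpow_lt_top_of_nonneg (by norm_num) ENNReal.ofNat_ne_top) ?_
        refine ENNReal.add_lt_top.2 ⟨hn.trans_lt ENNReal.one_lt_top, ?_⟩
        exact (hS.lintegral_prod_cube_le hE hν hu₀ n hT).trans_lt (cube_const_ne_top (ν := ν) hu₀ T).lt_top

/-- **Almost every slice of the limit is in `L³`**: `∫|u(t)|³ < ∞` for a.e. `t ∈ (0, T)` (Tonelli).
Requires `dim E = 3`. [folklore] -/
theorem IsLerayRegularisedScheme.ae_lintegral_cube_slice_lt_top (hE : Module.finrank ℝ E = 3)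
    (hS : IsLerayRegularisedScheme ν u₀ φ U) (hν : 0 < ν) (hu₀ : MemLp u₀ 2 volume)
    (hW : IsSliceWeakLimit U u₀ u)
    (hmeas : AEStronglyMeasurable (uncurry u) ((volume.restrict (Ioi (0 : ℝ))).prod (volume : Measure E)))
    (hae : ∀ᵐ t ∂(volume.restrict (Ioi (0 : ℝ))),
      Tendsto (fun n => eLpNorm (U n t - u t) 2 volume) atTop (𝓝 0)) {T : ℝ} (hT : 0 ≤ T) :
    ∀ᵐ t ∂(volume.restrict (Ioo (0 : ℝ) T)), ∫⁻ x, ‖u t x‖ₑ ^ (3 : ℝ) < ∞ := by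
  have hmeasu : AEStronglyMeasurable (uncurry u)
      ((volume.restrict (Ioo (0 : ℝ) T)).prod (volume : Measure E)) :=
    hmeas.mono_measure (prod_restrict_Ioo_le_prod_restrict_Ioi T)
  have hm : AEMeasurable (fun z : ℝ × E => ‖u z.1 z.2‖ₑ ^ (3 : ℝ))
      ((volume.restrict (Ioo (0 : ℝ) T)).prod (volume : Measure E)) :=
    hmeasu.enorm.pow_const _
  have h := hS.lintegral_prod_cube_limit_lt_top hE hν hu₀ hW hmeas hae hT
  rw [lintegral_prod _ hm] at h
  exact ae_lt_top' hm.lintegral_prod_right' h.ne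

/-- **Mollification of the limit converges in `L³` of every slab**: `∫₀ᵀ ‖J_{φ n} u(t) − u(t)‖₃³ dt → 0`
(slice-wise `L³` convergence of the mollifications of an `L³` function as the radii tend to `0`,
dominated by `8‖u(t)‖₃³`, integrable on `(0, T)`). The iterated form; the slice functionals are
a.e. measurable through a jointly measurable representative of `u`. Requires `dim E = 3`. [folklore] -/
theorem IsLerayRegularisedScheme.tendsto_lintegral_mollify_limit_sub
    (hE : Module.finrank ℝ E = 3)
    (hS : IsLerayRegularisedScheme ν u₀ φ U) (hν : 0 < ν) (hu₀ : MemLp u₀ 2 volume)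
    (hW : IsSliceWeakLimit U u₀ u)
    (hmeas : AEStronglyMeasurable (uncurry u) ((volume.restrict (Ioi (0 : ℝ))).prod (volume : Measure E)))
    (hae : ∀ᵐ t ∂(volume.restrict (Ioi (0 : ℝ))),
      Tendsto (fun n => eLpNorm (U n t - u t) 2 volume) atTop (𝓝 0)) {T : ℝ} (hT : 0 ≤ T) :
    Tendsto (fun n => ∫⁻ t in Ioo 0 T, (∫⁻ x, ‖mollify (φ n) (u t) x - u t x‖ₑ ^ (3 : ℝ)))
      atTop (𝓝 0) := by
  set μt : Measure ℝ := volume.restrict (Ioo (0 : ℝ) T) with hμt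
  have hmeasu : AEStronglyMeasurable (uncurry u) (μt.prod (volume : Measure E)) :=
    hmeas.mono_measure (prod_restrict_Ioo_le_prod_restrict_Ioi T)
  -- a jointly strongly measurable representative and the good times
  obtain ⟨w, hw, huw⟩ := hmeasu
  have hslice : ∀ᵐ t ∂μt, u t =ᵐ[volume] fun x => w (t, x) := by
    have h := Measure.ae_ae_of_ae_prod huw
    filter_upwards [h] with t ht
    filter_upwards [ht] with x hx
    exact hx
  -- the slice functionals and their measurable versions
  set F : ℕ → ℝ → ℝ≥0∞ := fun n t => ∫⁻ x, ‖mollify (φ n) (u t) x - u t x‖ₑ ^ (3 : ℝ) with hF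
  set Fw : ℕ → ℝ → ℝ≥0∞ := fun n t =>
    ∫⁻ x, ‖mollify (φ n) (fun y => w (t, y)) x - w (t, x)‖ₑ ^ (3 : ℝ) with hFw
  have hFw_meas : ∀ n, AEMeasurable (Fw n) μt := fun n => by
    have h1 : StronglyMeasurable (uncurry fun t x => mollify (φ n) (fun y => w (t, y)) x) :=
      stronglyMeasurable_uncurry_convolution_lsmul (φ n).continuous_normed
        (W := fun t y => w (t, y)) hw
    have h2 : AEMeasurable (fun z : ℝ × E =>
        ‖mollify (φ n) (fun y => w (z.1, y)) z.2 - w (z.1, z.2)‖ₑ ^ (3 : ℝ)) (μt.prod volume) := by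
      have h3 : StronglyMeasurable fun z : ℝ × E => mollify (φ n) (fun y => w (z.1, y)) z.2 - w z :=
        h1.sub hw
      exact (h3.measurable.enorm.pow_const _).aemeasurable
    exact h2.lintegral_prod_right'
  have hFF : ∀ n, F n =ᵐ[μt] Fw n := fun n => by
    filter_upwards [hslice] with t ht
    simp only [hF, hFw]
    refine lintegral_congr_ae ?_
    filter_upwards [ht] with x hx
    rw [hx, mollify_def, mollify_def, convolution_lsmul_congr_ae_right _ ht x]
  have hFm : ∀ n, AEMeasurable (F n) μt := fun n => (hFw_meas n).congr (hFF n).symm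
  -- `L³` slices
  have hL3 : ∀ᵐ t ∂μt, MemLp (u t) 3 volume := by
    filter_upwards [hS.ae_lintegral_cube_slice_lt_top hE hν hu₀ hW hmeas hae hT,
      ae_restrict_mem (measurableSet_Ioo : MeasurableSet (Ioo (0 : ℝ) T))] with t ht ht'
    refine ⟨(hW.memLp t ht'.1.le).1, ?_⟩
    rw [eLpNorm_eq_lintegral_rpow_enorm_toReal (by norm_num) (by norm_num), ENNReal.toReal_ofNat]
    exact ENNReal.rpow_lt_top_of_nonneg (by norm_num) ht.ne
  -- the bound `8 ‖u t‖₃³`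
  set B : ℝ → ℝ≥0∞ := fun t => 2 ^ (3 - 1 : ℝ) * (2 * ∫⁻ x, ‖u t x‖ₑ ^ (3 : ℝ)) with hB
  have hFB : ∀ n, F n ≤ᵐ[μt] B := fun n => by
    filter_upwards [hL3] with t ht
    simp only [hF, hB]
    have hJ : ∫⁻ x, ‖mollify (φ n) (u t) x‖ₑ ^ (3 : ℝ) ≤ ∫⁻ x, ‖u t x‖ₑ ^ (3 : ℝ) := by
      rw [lintegral_enorm_rpow_three_eq₀, lintegral_enorm_rpow_three_eq₀]
      gcongr
      exact FunctionSpaces.eLpNorm_normed_convolution_le (φ n) ht.1 (by norm_num)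
    calc ∫⁻ x, ‖mollify (φ n) (u t) x - u t x‖ₑ ^ (3 : ℝ)
        ≤ ∫⁻ x, 2 ^ (3 - 1 : ℝ) * (‖mollify (φ n) (u t) x‖ₑ ^ (3 : ℝ) + ‖u t x‖ₑ ^ (3 : ℝ)) := by
          refine lintegral_mono fun x => ?_
          exact (ENNReal.rpow_le_rpow (enorm_sub_le (E := E)) (by norm_num)).trans
            (ENNReal.rpow_add_le_mul_rpow_add_rpow _ _ (by norm_num))
      _ = 2 ^ (3 - 1 : ℝ) * ((∫⁻ x, ‖mollify (φ n) (u t) x‖ₑ ^ (3 : ℝ)) + ∫⁻ x, ‖u t x‖ₑ ^ (3 : ℝ)) := by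
          rw [lintegral_const_mul' _ _ (ENNReal.rpow_ne_top_of_nonneg (by norm_num) ENNReal.ofNat_ne_top),
            lintegral_add_right' _ (ht.1.enorm.pow_const _)]
      _ ≤ 2 ^ (3 - 1 : ℝ) * (2 * ∫⁻ x, ‖u t x‖ₑ ^ (3 : ℝ)) := by
          gcongr
          rw [two_mul]
          gcongr
  have hBfin : ∫⁻ t, B t ∂μt ≠ ∞ := by
    have hm : AEMeasurable (fun z : ℝ × E => ‖u z.1 z.2‖ₑ ^ (3 : ℝ)) (μt.prod (volume : Measure E)) :=
      (AEStronglyMeasurable.enorm ⟨w, hw, huw⟩).pow_const _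
    have h := hS.lintegral_prod_cube_limit_lt_top hE hν hu₀ hW hmeas hae hT
    rw [lintegral_prod _ hm] at h
    simp only [hB]
    rw [lintegral_const_mul'' _ ((hm.lintegral_prod_right').const_mul _),
      lintegral_const_mul'' _ hm.lintegral_prod_right']
    exact ENNReal.mul_ne_top (ENNReal.rpow_ne_top_of_nonneg (by norm_num) ENNReal.ofNat_ne_top)
      (ENNReal.mul_ne_top ENNReal.ofNat_ne_top h.ne)
  -- slice-wise convergence
  have hlim : ∀ᵐ t ∂μt, Tendsto (fun n => F n t) atTop (𝓝 0) := by
    filter_upwards [hL3] with t ht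
    have h1 := FunctionSpaces.tendsto_eLpNorm_normed_convolution_sub_self (μ := (volume : Measure E))
      hS.tendsto_rOut (p := 3) (by norm_num) (by norm_num) ht
    have h2 : Tendsto (fun n => eLpNorm ((φ n).normed volume ⋆[lsmul ℝ ℝ, volume] u t - u t) 3 volume
        ^ (3 : ℝ)) atTop (𝓝 0) := by
      have := ((ENNReal.continuous_rpow_const (y := (3 : ℝ))).tendsto 0).comp h1
      rwa [ENNReal.zero_rpow_of_pos (by norm_num)] at this
    refine h2.congr fun n => ?_
    simp only [hF]
    rw [← lintegral_enorm_rpow_three_eq₀]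
    rfl
  have hDC := tendsto_lintegral_of_dominated_convergence' B hFm hFB hBfin hlim
  rwa [lintegral_zero] at hDC

/-- **The mollified velocities converge to the limit in `L³` of every slab**:
`∫₀ᵀ∫ |J_{φ n}(U n) − u|³ → 0` (product-measure form), since slice-wise
`‖J(U n t) − u t‖₃ ≤ ‖U n t − u t‖₃ + ‖J u t − u t‖₃`. Requires `dim E = 3`.
[cite: CaffarelliKohnNirenberg1982, Appendix] -/
theorem IsLerayRegularisedScheme.tendsto_lintegral_prod_mollify_sub_cube (hE : Module.finrank ℝ E = 3)
    (hS : IsLerayRegularisedScheme ν u₀ φ U) (hν : 0 < ν) (hu₀ : MemLp u₀ 2 volume)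
    (hW : IsSliceWeakLimit U u₀ u)
    (hmeas : AEStronglyMeasurable (uncurry u) ((volume.restrict (Ioi (0 : ℝ))).prod (volume : Measure E)))
    (hae : ∀ᵐ t ∂(volume.restrict (Ioi (0 : ℝ))),
      Tendsto (fun n => eLpNorm (U n t - u t) 2 volume) atTop (𝓝 0)) {T : ℝ} (hT : 0 ≤ T) :
    Tendsto (fun n => ∫⁻ z, ‖mollify (φ n) (U n z.1) z.2 - u z.1 z.2‖ₑ ^ (3 : ℝ)
      ∂((volume.restrict (Ioo (0 : ℝ) T)).prod (volume : Measure E))) atTop (𝓝 0) := by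
  set μt : Measure ℝ := volume.restrict (Ioo (0 : ℝ) T) with hμt
  have c3 : (2 : ℝ≥0∞) ^ (3 - 1 : ℝ) ≠ ∞ := ENNReal.rpow_ne_top_of_nonneg (by norm_num) ENNReal.ofNat_ne_top
  -- the two iterated majorants
  set A : ℕ → ℝ≥0∞ := fun n => ∫⁻ t, (∫⁻ x, ‖U n t x - u t x‖ₑ ^ (3 : ℝ)) ∂μt with hA
  set Bm : ℕ → ℝ≥0∞ := fun n => ∫⁻ t, (∫⁻ x, ‖mollify (φ n) (u t) x - u t x‖ₑ ^ (3 : ℝ)) ∂μt with hBm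
  have hA0 : Tendsto A atTop (𝓝 0) := by
    have h := hS.tendsto_lintegral_prod_sub_cube hE hν hu₀ hW hmeas hae hT
    refine h.congr fun n => ?_
    have hm : AEMeasurable (fun z : ℝ × E => ‖U n z.1 z.2 - u z.1 z.2‖ₑ ^ (3 : ℝ)) (μt.prod volume) :=
      ((hS.aestronglyMeasurable_uncurry_slab n T).sub
        (hmeas.mono_measure (prod_restrict_Ioo_le_prod_restrict_Ioi T))).enorm.pow_const _
    exact lintegral_prod _ hm
  have hB0 : Tendsto Bm atTop (𝓝 0) := hS.tendsto_lintegral_mollify_limit_sub hE hν hu₀ hW hmeas hae hT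
  -- slice-wise comparison
  have hslice : ∀ n, ∀ t ∈ Ioo (0 : ℝ) T,
      ∫⁻ x, ‖mollify (φ n) (U n t) x - u t x‖ₑ ^ (3 : ℝ) ≤
        2 ^ (3 - 1 : ℝ) * ((∫⁻ x, ‖U n t x - u t x‖ₑ ^ (3 : ℝ)) +
          ∫⁻ x, ‖mollify (φ n) (u t) x - u t x‖ₑ ^ (3 : ℝ)) := by
    intro n t ht
    have hUl : LocallyIntegrable (U n t) volume := (hS.memLp n ht.1.le).locallyIntegrable one_le_two
    have hul : LocallyIntegrable (u t) volume := (hW.memLp t ht.1.le).locallyIntegrable one_le_two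
    have hlin : mollify (φ n) (U n t) - mollify (φ n) (u t) = mollify (φ n) (U n t - u t) := by
      rw [mollify_def, mollify_def, mollify_def, normed_convolution_sub (φ n) hUl hul]
    have hY : ∫⁻ x, ‖mollify (φ n) (U n t - u t) x‖ₑ ^ (3 : ℝ) ≤ ∫⁻ x, ‖U n t x - u t x‖ₑ ^ (3 : ℝ) := by
      have e2 : ∫⁻ x, ‖U n t x - u t x‖ₑ ^ (3 : ℝ) = eLpNorm (U n t - u t) 3 volume ^ (3 : ℝ) :=
        lintegral_enorm_rpow_three_eq₀ volume (U n t - u t)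
      rw [lintegral_enorm_rpow_three_eq₀, e2]
      gcongr
      exact FunctionSpaces.eLpNorm_normed_convolution_le (φ n)
        ((hS.memLp n ht.1.le).1.sub (hW.memLp t ht.1.le).1) (by norm_num)
    have hmeas3 : AEMeasurable (fun x => ‖mollify (φ n) (u t) x - u t x‖ₑ ^ (3 : ℝ)) volume := by
      have hc : Continuous (mollify (φ n) (u t)) :=
        (contDiff_normed_convolution_of_locallyIntegrable (φ n) hul (n := 0)).continuous
      exact (hc.aestronglyMeasurable.sub (hW.memLp t ht.1.le).1).enorm.pow_const _
    calc ∫⁻ x, ‖mollify (φ n) (U n t) x - u t x‖ₑ ^ (3 : ℝ)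
        = ∫⁻ x, ‖(mollify (φ n) (U n t - u t) x) + (mollify (φ n) (u t) x - u t x)‖ₑ ^ (3 : ℝ) := by
          refine lintegral_congr fun x => ?_
          have e : mollify (φ n) (U n t - u t) x = mollify (φ n) (U n t) x - mollify (φ n) (u t) x := by
            rw [← hlin]; rfl
          rw [e]
          congr 2
          abel
      _ ≤ ∫⁻ x, 2 ^ (3 - 1 : ℝ) * (‖mollify (φ n) (U n t - u t) x‖ₑ ^ (3 : ℝ) +
            ‖mollify (φ n) (u t) x - u t x‖ₑ ^ (3 : ℝ)) := by
          refine lintegral_mono fun x => ?_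
          exact (ENNReal.rpow_le_rpow (enorm_add_le _ _) (by norm_num)).trans
            (ENNReal.rpow_add_le_mul_rpow_add_rpow _ _ (by norm_num))
      _ = 2 ^ (3 - 1 : ℝ) * ((∫⁻ x, ‖mollify (φ n) (U n t - u t) x‖ₑ ^ (3 : ℝ)) +
            ∫⁻ x, ‖mollify (φ n) (u t) x - u t x‖ₑ ^ (3 : ℝ)) := by
          rw [lintegral_const_mul' _ _ c3, lintegral_add_right' _ hmeas3]
      _ ≤ _ := by gcongr
  -- conclude by comparison with the iterated majorants
  have hmaj : ∀ n, ∫⁻ z, ‖mollify (φ n) (U n z.1) z.2 - u z.1 z.2‖ₑ ^ (3 : ℝ) ∂(μt.prod (volume : Measure E))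
      ≤ 2 ^ (3 - 1 : ℝ) * (A n + Bm n) := fun n => by
    calc ∫⁻ z, ‖mollify (φ n) (U n z.1) z.2 - u z.1 z.2‖ₑ ^ (3 : ℝ) ∂(μt.prod (volume : Measure E))
        ≤ ∫⁻ t, (∫⁻ x, ‖mollify (φ n) (U n t) x - u t x‖ₑ ^ (3 : ℝ)) ∂μt := lintegral_prod_le _
      _ ≤ ∫⁻ t, 2 ^ (3 - 1 : ℝ) * ((∫⁻ x, ‖U n t x - u t x‖ₑ ^ (3 : ℝ)) +
            ∫⁻ x, ‖mollify (φ n) (u t) x - u t x‖ₑ ^ (3 : ℝ)) ∂μt := by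
          refine lintegral_mono_ae ?_
          filter_upwards [ae_restrict_mem (measurableSet_Ioo : MeasurableSet (Ioo (0 : ℝ) T))] with t ht
          exact hslice n t ht
      _ ≤ 2 ^ (3 - 1 : ℝ) * (A n + Bm n) := by
          rw [lintegral_const_mul' _ _ c3]
          gcongr
          have hm : AEMeasurable (fun t => ∫⁻ x, ‖U n t x - u t x‖ₑ ^ (3 : ℝ)) μt := by
            have h : AEMeasurable (fun z : ℝ × E => ‖U n z.1 z.2 - u z.1 z.2‖ₑ ^ (3 : ℝ)) (μt.prod volume) :=
              ((hS.aestronglyMeasurable_uncurry_slab n T).sub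
                (hmeas.mono_measure (prod_restrict_Ioo_le_prod_restrict_Ioi T))).enorm.pow_const _
            exact h.lintegral_prod_right'
          rw [lintegral_add_left' hm]
  have hlim : Tendsto (fun n => 2 ^ (3 - 1 : ℝ) * (A n + Bm n)) atTop (𝓝 0) := by
    have h := hA0.add hB0
    rw [add_zero] at h
    have h2 := ENNReal.Tendsto.const_mul h (Or.inr c3)
    rwa [mul_zero] at h2
  exact tendsto_of_tendsto_of_tendsto_of_le_of_le tendsto_const_nhds hlim (fun _ => zero_le) hmaj

end CubicAndMollified

end Literature.Analysis.FluidPDE
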